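import Summits.KontsevichZagierPeriods.KontsevichZagierPeriods.Theses.FurushoPentagon
import Summits.KontsevichZagierPeriods.KontsevichZagierPeriods.Theorems.FurushoPentagonReducedPeriodRingDefs

/-!
# `ReducedPeriodRing`, line `effective-end-monoid`: cubical additivity and change of variables

Stub `stub_cubeAddCov_sound` (S2a) of the crux `FurushoPentagon.ReducedPeriodRing`
(stmt-KontsevichZagierPeriods-3929), line `effective-end-monoid`.

The two cubical move families `cubeIntegrandAddRel` (integrand additivity between tame cube
classes) and `cubeChangeOfVariablesRel` (change of variables along a `ℚ`-semialgebraic analytic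
diffeomorphism of the cube onto itself) are literal instances of the Kontsevich–Zagier moves
`KZ.integrandAddRel` and `KZ.changeOfVariablesRel`: all representations involved have domain the
closed unit cube, so the "same domain" and "image domain" clauses of the KZ moves hold, and the
remaining clauses are copied over. Hence both families lie in `KZ.relations`.

References: M. Kontsevich, D. Zagier, *Periods* (2001), §1.2 rules (1), (2).
-/

noncomputable section

namespace Summit.KontsevichZagierPeriods.FurushoPentagon.ReducedPeriodRing

open Set
open Literature.NumberTheory.Transcendental Literature.NumberTheory.Transcendental.KZ

/-- Cubical integrand additivity is an instance of the KZ integrand-additivity move.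
[Kontsevich–Zagier 2001, §1.2 rule (1)] -/
private theorem cubeIntegrandAddRel_subset_integrandAddRel :
    cubeIntegrandAddRel ⊆ integrandAddRel := by
  rintro c ⟨n, r, r₁, r₂, hr, -, hr₁, -, hr₂, -, hEq, hc⟩
  exact ⟨n, r, r₁, r₂, hr₁.trans hr.symm, hr₂.trans hr.symm, hr ▸ hEq, hc⟩

/-- Cubical change of variables is an instance of the KZ change-of-variables move.
[Kontsevich–Zagier 2001, §1.2 rule (2)] -/
private theorem cubeChangeOfVariablesRel_subset_changeOfVariablesRel :
    cubeChangeOfVariablesRel ⊆ changeOfVariablesRel := by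
  rintro c ⟨n, r, r', Φ, Φ', hr, -, hr', -, hΦ, hΦ', hinj, himg, -, hEq, hc⟩
  refine ⟨n, r, r', Φ, Φ', ?_, ?_, ?_, ?_, ?_, hc⟩
  · rwa [hr]
  · rwa [hr]
  · rwa [hr]
  · rw [hr, himg, hr']
  · rwa [hr]

/-- **S2a (soundness of cubical integrand additivity and change of variables).** Both families are
instances of the corresponding KZ moves. [Kontsevich–Zagier 2001, §1.2 rules (1), (2)] -/
theorem stub_cubeAddCov_sound :
    cubeIntegrandAddRel ∪ cubeChangeOfVariablesRel ⊆ (relations : Set FormalRep) := by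
  rintro c (hc | hc)
  · exact integrandAddRel_subset_relations (cubeIntegrandAddRel_subset_integrandAddRel hc)
  · exact changeOfVariablesRel_subset_relations
      (cubeChangeOfVariablesRel_subset_changeOfVariablesRel hc)

end Summit.KontsevichZagierPeriods.FurushoPentagon.ReducedPeriodRing
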